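import Mathlib
import HarnessLib
import Summits.Langlands.Statement
import Summits.Langlands.Langlands.Theses.AuxiliaryLevelSplit
import Summits.Langlands.Langlands.Theses.PrimeSwitchSplit
import Summits.Langlands.Langlands.Theorems.TransientLevelSplitLevelFiniteness
import Summits.Langlands.Langlands.Theorems.DepthPrimeSplitClassicalityWeight
import Literature.NumberTheory.Automorphic.JacquetLanglandsParts
import Literature.NumberTheory.Automorphic.IwahoriGL
import Literature.NumberTheory.GaloisRepresentations.LAdicCharacterUnramifiedAEProofs

/-!
Landing form: the node HOME/nodes/lens-3-g25-IwahoriTransientSplit.lean split for the 400-line lint — THIS file = §§1–7, 9 (items, kernels, closes,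
necessity, g24 relations, frames); the CERTIFICATE §8 + the BC5 model witness §8b = `Theorems/IwahoriTransientSplitCertificate.lean` (Mathlib-only, independent).

# IwahoriTransientSplit (landing part 2/2: the split) — lens-3 gen 25 node of the cell `decomp-langlands` (planner-decomp-langlands-lens-3-g25-0, 2026-08-31)

TransientLevelSplit v2 (REFINES the gen-24 node `Theorems.TransientLevel`, whose vocabulary is reused BY NAME; supersedes the unfiled
gen-24 child-route kit).  TARGET (by name): `Summit.Langlands.Langlands.Theses.AuxiliaryLevelSplit.LevelFiniteness` = stmt-Langlands-27042
(crux rank 3, the DECLARED RESIDUAL of route-Langlands-AuxiliaryLevelSplit — this lineage's gen-20 child of `DepthPrimeSplit.FernSpread`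
25024; route OPEN, tribunal r0 passed 2026-08-31T10:48Z; leaf IDEA-NEEDED(level finiteness); never cut as an item).

U(ρ): for irreducible pinned-geometric `ρ : Γ_K → GL_n(ℚ̄_ℓ)`:  H∞(ρ) «LEVEL-FREE pro-automorphy: for every radius r > 0 SOME L-algebraic
cuspidal π_r is r-close to ρ at ALMOST ALL places» ⟹ C(ρ) «pro-automorphy of BOUNDED level: ONE finite S serves every radius at EVERY v ∉ S».

THE ONE CERTIFIED TRANSLATION (lens-3's single allowed EQUIV, kernel `levelFiniteness_iff_pieces`, modulo NOTHING):
    U  ⟺  SemistableShaping ∧ IwahoriLevelConfinement,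
through the NEW intermediate language H♯(ρ) «SEMISTABLY SHAPED pro-automorphy» (`IsShapedProAutomorphic`): there is ONE finite set S₀
(depending on ρ only) such that for every radius r > 0 some L-algebraic cuspidal π is r-close to ρ at almost all places AND, at EVERY
place v ∉ S₀, EITHER r-close to ρ at v OR «Iwahori-spherical at v (`IsIwahoriSphericalAt`: the local component π_v has a non-zero vector
fixed by the Iwahori subgroup `Literature.NumberTheory.Automorphic.iwahoriGL n K_v`) while ρ carries a LEVEL-RAISING PAIR at v modulo r
(`IsLevelRaisingAt`: two roots a, b of charpoly ρ(Frob_v), counted with multiplicity, with |a − q_v·b|_ℓ < r)».  The ladder of depths is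
    C ⟹ H♯ ⟹ H∞        (kernels `shaped_of_pro`, `levelFree_of_shaped`: pure logic),
and U = (H∞ ⟹ C) splits at H♯:
  • SSH = `SemistableShaping` : H∞ ⟹ H♯ — «outside a finite set depending on ρ alone, the auxiliary level of every sufficiently deep
    approximant is at worst IWAHORI, and sits exactly at the depth-r level-raising places of ρ».  Crux rank 2, deciding, ATTACKABLE, and —
    the point of this generation — WITHOUT the Frobenius-genericity hypothesis that the gen-24 piece U₁ = `PlacewiseLevelControl` needed:
    MECHANISM (INERTIAL EIGENVALUE RIGIDITY, certified in §8 below with 0 sorry): if π is Hecke-congruent to ρ modulo a deep radius at almost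
    all places and has a Galois avatar ρ_π with local–global compatibility at v ∤ ℓ (the direction-(A) cores W⁺ 17415 / L∤R 18084 of the
    host lineage), then (Čebotarev + continuity) tr ρ_π ≈ tr ρ on all of Γ_K, so at a place v where ρ is unramified the characteristic
    polynomial of ρ_π(τ), τ ∈ I_v, is coefficientwise close to (X − 1)^n; its roots are roots of unity (Grothendieck: ρ_π|_{I_v} is
    quasi-unipotent), and a root of unity ζ ≠ 1 in ℚ̄_ℓ satisfies |ζ − 1|^{ℓ−1} ≥ |ℓ| (`norm_natCast_le_norm_sub_one_pow`, CYCLOTOMIC RIGIDITY),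
    so closeness below the PLACE-INDEPENDENT radius |ℓ|^n forces ζ = 1 (`eq_one_of_coeff_lt`): ρ_π(I_v) is unipotent, the Weil–Deligne type
    of π_v is (unramified, N) — π_v is IWAHORI-SPHERICAL (Borel–Casselman) — and either N = 0 (π_v unramified with Satake polynomial close to
    charpoly ρ(Frob_v): the place is GOOD) or N ≠ 0, which puts two Frobenius eigenvalues of ρ_π in ratio q_v exactly, hence (root
    continuity) a level-raising pair of ρ at v modulo r.  No genericity, no purity, no Shimura variety: S₀ = ram(ρ) ∪ {v ∣ ℓ}.
  • ILC = `IwahoriLevelConfinement` : H♯ ⟹ C — «semistably shaped pro-automorphy ⟹ ONE uniform finite level»: the genuine LEVEL-LOWERING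
    content, now confined to IWAHORI level at LEVEL-RAISING places (Mazur's principle when q_v ≢ 1, Ribet's theorem when q_v ≡ 1, modulo ℓ^m
    with free weight; Khare 2004 Prop. 1, Dummigan, Camporino–Pacetti, Jarvis/Rajaei/Fujiwara over totally real K; CHT's Ihara lemma /
    Boyer for n ≥ 3).  Crux rank 3, DECLARED RESIDUAL, strictly WEAKER than U (kernel `confinement_of_levelFiniteness`; its hypothesis H♯ is
    the OPEN conclusion of SSH) and sharper than every earlier residual of the lineage: the approximants it receives have NO wild and NO
    non-unipotent tame level left to remove.
Both pieces are IMPLIED BY THE TARGET (`shaping_of_levelFiniteness`, `confinement_of_levelFiniteness`), hence by FERN (`…_of_fernSpread`), by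
B_w = 17414 (`…_of_weak`) and by the summit (`…_of_langlands`): no EXCESS.  ILC ⟺ U only modulo SSH (open): two OPEN pieces.  The join
`closes_target` is composition (trivial seam — informational; the content is in the two pieces).

RELATION TO THE GEN-24 PIECES (§7, all kernel-checked): with U₁ = `TransientLevel.PlacewiseLevelControl` (H∞ ⟹ C_pt) and
U₂ = `TransientLevel.UniformLevelControl` (C_pt ⟹ C):  SSH ∧ ILC ⟹ U₂ (`uniform_of_shaping_confinement`) and U₁ ∧ U₂ ⟹ U ⟹ SSH ∧ ILC;
the weakest residual form implied by BOTH residuals is IWC_pt = `PlacewiseIwahoriConfinement` ((H♯ ∧ C_pt) ⟹ C), and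
U ⟺ U₁ ∧ SSH ∧ IWC_pt (`levelFiniteness_iff_pieces3`), U₂ ⟺ (C_pt ⟹ H♯) ∧ IWC_pt (`uniformLevelControl_iff_layer2`).

| piece | decl | vs U | status | leaf |
|---|---|---|---|---|
| SSH | `SemistableShaping` (crux r2, deciding) | WEAKER (kernel `shaping_of_levelFiniteness`; not known to imply U: for each depth the level-raising places of ρ have positive density — Čebotarev in ρ mod ℓ^m ⊕ cyclotomic — so Iwahori level may wander through an infinite set; KLR arXiv:math/0309283 p.2, Khare arXiv:math/0210296 Step 1, Camporino–Pacetti arXiv:1312.4925 Thm A) | OPEN | ATTACKABLE (inertial rigidity = §8 PROVED; inputs = avatars + local–global compatibility of the approximants: host cores W⁺ 17415 / L∤R 18084; unconditional where those are theorems, e.g. regular approximants over CM/totally real K) |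
| ILC | `IwahoriLevelConfinement` (crux r3, declared residual) | WEAKER (kernel `confinement_of_levelFiniteness`; hypothesis H♯ is SSH's open conclusion, so ILC is silent about every merely level-free ρ) | OPEN | ATTACKABLE n ≤ 2 over totally real K, ρ odd, residually big (Mazur principle + Ribet mod ℓ^m, free weight) · IDEA-NEEDED n ≥ 3 (Ihara) · BARRIER at l₀ > 0 (`ShimuraVarietyRealizationBarrier`) |

Kernels: `closes_target` (SSH → ILC → U, by name, both binders used) · `levelFiniteness_iff_pieces` (THE EQUIV) · `shaping_of_levelFiniteness`,
`confinement_of_levelFiniteness` · `…_of_fernSpread` · `…_of_weak` (B_w 17414 by name) · `…_of_langlands` (through the tree theorem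
`Theorems.DepthPrimeSplitClassicalityWeight.weak_of_langlands`) · §7 gen-24 relations · §8 THE CERTIFICATE (cyclotomic rigidity and inertial
eigenvalue rigidity over `PadicAlgCl ℓ`, fully proved) · `closes_parent` (G → SSH → ILC → FERN) · `closes_root` (ten binders → `_root_.Langlands`).
0 sorry; axioms propext / Classical.choice / Quot.sound only.  WHY NOVEL: no cell object (census v28, TREE v4.96, CRITIC-LEDGER ≤ 364) and no
corpus/galaxy hit types «ℓ-adic approximants of a fixed geometric ρ are eventually semistable at every good place of ρ, uniformly, by
cyclotomic rigidity of inertial eigenvalues»; nearest: this lineage's gen-24 transience-at-generic-places (needs genericity; seam C_pt) and the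
necessity half of Diamond–Taylor level raising modulo prime powers (arXiv:1811.05702 Prop. 2.5, GL₂/ℚ, fixed weight).
-/

set_option linter.dupNamespace false
set_option linter.unusedVariables false

namespace Summit.Langlands.Langlands.Theorems.IwahoriTransient

open scoped NumberField Polynomial
open Filter Field IsDedekindDomain
open Literature.NumberTheory.GaloisRepresentations Literature.NumberTheory.Automorphic
open Summit.Langlands.Langlands.Theorems.TransientLevel

/-! ## 1. Vocabulary (the NEW intermediate language; the gen-24 vocabulary `IsPinnedGeometric`, `CloseAt`, `IsLevelFreeProAutomorphic`,
`IsPlacewiseProAutomorphic`, `IsProAutomorphic`, `IsWeaklyAutomorphic` is imported from `Theorems.TransientLevel` BY NAME) -/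

section Vocabulary

variable {K : Type} [Field K] [NumberField K] {n : ℕ} {ℓ : ℕ} [Fact ℓ.Prime]

/-- `π` is IWAHORI-SPHERICAL at `v`: its local component `π_v` (Borel–Jacquet `HasLocalComponentAt`, an accepted `SmoothIrrep`) has a
non-zero vector fixed by the Iwahori subgroup of `GL_n(K_v)` (tree `iwahoriGL`; phrasing as in `Theses.IwahoriBlockSplit`).  Under the local
Langlands correspondence: the Weil–Deligne parameter of `π_v` is trivial on inertia (Borel 1976 / Casselman 1980: Iwahori-spherical =
constituents of unramified principal series). -/
def IsIwahoriSphericalAt {hcpt : isCompact_glFiniteIntegralLevel n K} (π : CuspidalAutomorphicRepData n K hcpt)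
    (v : HeightOneSpectrum (𝓞 K)) : Prop :=
  ∃ πv : SmoothIrrep (GL (Fin n) (v.adicCompletion K)), π.1.HasLocalComponentAt v πv.ρ ∧
    ∃ w : πv.V, w ≠ 0 ∧ ∀ g ∈ iwahoriGL n (v.adicCompletion K), πv.ρ g w = w

/-- `ρ` has a LEVEL-RAISING PAIR at `v` modulo the radius `r`: for every arithmetic Frobenius `σ` at a prime over `v`, two roots `a, b` of
`charpoly ρ(σ)` — counted with multiplicity: `{a, b} ≤ roots` — satisfy `|a − q_v·b|_ℓ < r` (the ℓ-adic form, at depth r, of the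
Ribet/Diamond–Taylor level-raising congruence `α_i ≡ q_v·α_j`; for n = 1 it is `False`). -/
def IsLevelRaisingAt (ρ : FramedGaloisRep K (PadicAlgCl ℓ) n) (r : NNReal) (v : HeightOneSpectrum (𝓞 K)) : Prop :=
  ∀ 𝔓 ∈ v.primesAbove, ∀ σ : absoluteGaloisGroup K, IsArithFrobAt (𝓞 K) σ 𝔓 →
    ∃ a b : PadicAlgCl ℓ, ({a, b} : Multiset (PadicAlgCl ℓ)) ≤ (FramedRep.charpoly ρ σ).roots ∧
      Valued.v (a - (v.residueCard : PadicAlgCl ℓ) * b) < r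

/-- H♯ · SEMISTABLY SHAPED PRO-AUTOMORPHIC (the NEW intermediate language of this node): ONE finite `S₀` such that for every radius
`r > 0` some L-algebraic cuspidal `π` is `r`-close to `ρ` at almost all places and, at EVERY `v ∉ S₀`, either `r`-close to `ρ` at `v` or
Iwahori-spherical at `v` with `ρ` level-raising at `v` modulo `r`. -/
def IsShapedProAutomorphic (hcpt : isCompact_glFiniteIntegralLevel n K) (ι : PadicAlgCl ℓ ≃+* ℂ)
    (ρ : FramedGaloisRep K (PadicAlgCl ℓ) n) : Prop :=
  ∃ S₀ : Set (HeightOneSpectrum (𝓞 K)), S₀.Finite ∧ ∀ r : NNReal, 0 < r →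
    ∃ π : CuspidalAutomorphicRepData n K hcpt, π.1.IsLAlgebraic ∧
      (∀ᶠ v : HeightOneSpectrum (𝓞 K) in cofinite, CloseAt ι π ρ r v) ∧
      ∀ v : HeightOneSpectrum (𝓞 K), v ∉ S₀ → CloseAt ι π ρ r v ∨ (IsIwahoriSphericalAt π v ∧ IsLevelRaisingAt ρ r v)

end Vocabulary

/-! ## 2. The items (one-line texts = childroute.route.json VERBATIM; generated from the tree text of the target by texts25.py) -/

/-- SSH · SEMISTABLE SHAPING · crux rank 2 (deciding) · WEAKER than U (`shaping_of_levelFiniteness`) · OPEN · ATTACKABLE (inertial eigenvalue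
rigidity, §8).  The target's binders and hypotheses VERBATIM; conclusion H♯ instead of C. -/
def SemistableShaping : Prop :=
  ∀ (K : Type) [Field K] [NumberField K] (n : ℕ) (hcpt : Literature.NumberTheory.Automorphic.isCompact_glFiniteIntegralLevel n K), 0 < n → ∀ (ℓ : ℕ) [Fact ℓ.Prime] (ι : PadicAlgCl ℓ ≃+* ℂ) (ρ : Literature.NumberTheory.GaloisRepresentations.FramedGaloisRep K (PadicAlgCl ℓ) n), ρ.toGaloisRep.IsIrreducible → ((∀ᶠ v : IsDedekindDomain.HeightOneSpectrum (NumberField.RingOfIntegers K) in Filter.cofinite, ρ.IsUnramifiedAt v) ∧ ∀ (v : IsDedekindDomain.HeightOneSpectrum (NumberField.RingOfIntegers K)) (hv : ((ℓ : ℕ) : NumberField.RingOfIntegers K) ∈ v.asIdeal), (Literature.NumberTheory.PAdicHodge.fontainePstAdicCompletion v ℓ hv).IsDeRhamFramed (ρ.toLocal v)) → (∀ r : NNReal, 0 < r → ∃ π : Literature.NumberTheory.Automorphic.CuspidalAutomorphicRepData n K hcpt, π.1.IsLAlgebraic ∧ ∀ᶠ v : IsDedekindDomain.HeightOneSpectrum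 (NumberField.RingOfIntegers K) in Filter.cofinite, (∃ α : Multiset ℂ, π.1.HasSatakeParamAt v α ∧ ∀ 𝔓 ∈ v.primesAbove, ∀ σ : Field.absoluteGaloisGroup K, IsArithFrobAt (NumberField.RingOfIntegers K) σ 𝔓 → ∀ i : ℕ, Valued.v ((Literature.NumberTheory.GaloisRepresentations.FramedRep.charpoly ρ σ - Literature.NumberTheory.Automorphic.arithFrobPolyOfSatake ι v.residueCard 1 α).coeff i) < r)) → ∃ S₀ : Set (IsDedekindDomain.HeightOneSpectrum (NumberField.RingOfIntegers K)), S₀.Finite ∧ ∀ r : NNReal, 0 < r → ∃ π : Literature.NumberTheory.Automorphic.CuspidalAutomorphicRepData n K hcpt, π.1.IsLAlgebraic ∧ (∀ᶠ v : IsDedekindDomain.HeightOneSpectrum (NumberField.RingOfIntegers K) in Filter.cofinite, (∃ α : Multiset ℂ, π.1.HasSatakeParamAt v α ∧ ∀ 𝔓 ∈ v.primesAbove, ∀ σ : Field.absoluteGaloisGroup K, IsArithFrobAt (NumberField.RingOfIntegers K) σ 𝔓 → ∀ i : ℕ, Valued.v ((Literature.NumberTheory.GaloisRepresentations.FramedRep.charpoly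 ρ σ - Literature.NumberTheory.Automorphic.arithFrobPolyOfSatake ι v.residueCard 1 α).coeff i) < r)) ∧ ∀ v : IsDedekindDomain.HeightOneSpectrum (NumberField.RingOfIntegers K), v ∉ S₀ → (∃ α : Multiset ℂ, π.1.HasSatakeParamAt v α ∧ ∀ 𝔓 ∈ v.primesAbove, ∀ σ : Field.absoluteGaloisGroup K, IsArithFrobAt (NumberField.RingOfIntegers K) σ 𝔓 → ∀ i : ℕ, Valued.v ((Literature.NumberTheory.GaloisRepresentations.FramedRep.charpoly ρ σ - Literature.NumberTheory.Automorphic.arithFrobPolyOfSatake ι v.residueCard 1 α).coeff i) < r) ∨ ((∃ πv : Literature.NumberTheory.Automorphic.SmoothIrrep (Matrix.GeneralLinearGroup (Fin n) (v.adicCompletion K)), π.1.HasLocalComponentAt v πv.ρ ∧ ∃ w : πv.V, w ≠ 0 ∧ ∀ g ∈ Literature.NumberTheory.Automorphic.iwahoriGL n (v.adicCompletion K), πv.ρ g w = w) ∧ (∀ 𝔓 ∈ v.primesAbove, ∀ σ : Field.absoluteGaloisGroup K, IsArithFrobAt (NumberField.RingOfIntegers K) σ 𝔓 → ∃ a b :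 PadicAlgCl ℓ, ({a, b} : Multiset (PadicAlgCl ℓ)) ≤ (Literature.NumberTheory.GaloisRepresentations.FramedRep.charpoly ρ σ).roots ∧ Valued.v (a - (v.residueCard : PadicAlgCl ℓ) * b) < r))

/-- ILC · IWAHORI LEVEL CONFINEMENT · crux rank 3 (declared residual) · WEAKER than U (`confinement_of_levelFiniteness`) · OPEN ·
ATTACKABLE n ≤ 2 / totally real / odd · IDEA-NEEDED n ≥ 3 · BARRIER l₀ > 0.  The target's text VERBATIM with the hypothesis H∞ REPLACED by H♯. -/
def IwahoriLevelConfinement : Prop :=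
  ∀ (K : Type) [Field K] [NumberField K] (n : ℕ) (hcpt : Literature.NumberTheory.Automorphic.isCompact_glFiniteIntegralLevel n K), 0 < n → ∀ (ℓ : ℕ) [Fact ℓ.Prime] (ι : PadicAlgCl ℓ ≃+* ℂ) (ρ : Literature.NumberTheory.GaloisRepresentations.FramedGaloisRep K (PadicAlgCl ℓ) n), ρ.toGaloisRep.IsIrreducible → ((∀ᶠ v : IsDedekindDomain.HeightOneSpectrum (NumberField.RingOfIntegers K) in Filter.cofinite, ρ.IsUnramifiedAt v) ∧ ∀ (v : IsDedekindDomain.HeightOneSpectrum (NumberField.RingOfIntegers K)) (hv : ((ℓ : ℕ) : NumberField.RingOfIntegers K) ∈ v.asIdeal), (Literature.NumberTheory.PAdicHodge.fontainePstAdicCompletion v ℓ hv).IsDeRhamFramed (ρ.toLocal v)) → (∃ S₀ : Set (IsDedekindDomain.HeightOneSpectrum (NumberField.RingOfIntegers K)), S₀.Finite ∧ ∀ r : NNReal, 0 < r → ∃ π : Literature.NumberTheory.Automorphic.CuspidalAutomorphicRepData n K hcpt, π.1.IsLAlgebraic ∧ (∀ᶠ v : IsDedekindDomain.HeightOneSpectrum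 (NumberField.RingOfIntegers K) in Filter.cofinite, (∃ α : Multiset ℂ, π.1.HasSatakeParamAt v α ∧ ∀ 𝔓 ∈ v.primesAbove, ∀ σ : Field.absoluteGaloisGroup K, IsArithFrobAt (NumberField.RingOfIntegers K) σ 𝔓 → ∀ i : ℕ, Valued.v ((Literature.NumberTheory.GaloisRepresentations.FramedRep.charpoly ρ σ - Literature.NumberTheory.Automorphic.arithFrobPolyOfSatake ι v.residueCard 1 α).coeff i) < r)) ∧ ∀ v : IsDedekindDomain.HeightOneSpectrum (NumberField.RingOfIntegers K), v ∉ S₀ → (∃ α : Multiset ℂ, π.1.HasSatakeParamAt v α ∧ ∀ 𝔓 ∈ v.primesAbove, ∀ σ : Field.absoluteGaloisGroup K, IsArithFrobAt (NumberField.RingOfIntegers K) σ 𝔓 → ∀ i : ℕ, Valued.v ((Literature.NumberTheory.GaloisRepresentations.FramedRep.charpoly ρ σ - Literature.NumberTheory.Automorphic.arithFrobPolyOfSatake ι v.residueCard 1 α).coeff i) < r) ∨ ((∃ πv : Literature.NumberTheory.Automorphic.SmoothIrrep (Matrix.GeneralLinearGroup (Fin n) (v.adicCompletion K)), π.1.HasLocalComponentAt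 v πv.ρ ∧ ∃ w : πv.V, w ≠ 0 ∧ ∀ g ∈ Literature.NumberTheory.Automorphic.iwahoriGL n (v.adicCompletion K), πv.ρ g w = w) ∧ (∀ 𝔓 ∈ v.primesAbove, ∀ σ : Field.absoluteGaloisGroup K, IsArithFrobAt (NumberField.RingOfIntegers K) σ 𝔓 → ∃ a b : PadicAlgCl ℓ, ({a, b} : Multiset (PadicAlgCl ℓ)) ≤ (Literature.NumberTheory.GaloisRepresentations.FramedRep.charpoly ρ σ).roots ∧ Valued.v (a - (v.residueCard : PadicAlgCl ℓ) * b) < r))) → ∃ S : Set (IsDedekindDomain.HeightOneSpectrum (NumberField.RingOfIntegers K)), S.Finite ∧ ∀ r : NNReal, 0 < r → ∃ π : Literature.NumberTheory.Automorphic.CuspidalAutomorphicRepData n K hcpt, π.1.IsLAlgebraic ∧ ∀ v : IsDedekindDomain.HeightOneSpectrum (NumberField.RingOfIntegers K), v ∉ S → (∃ α : Multiset ℂ, π.1.HasSatakeParamAt v α ∧ ∀ 𝔓 ∈ v.primesAbove, ∀ σ : Field.absoluteGaloisGroup K, IsArithFrobAt (NumberField.RingOfIntegers K) σ 𝔓 →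 ∀ i : ℕ, Valued.v ((Literature.NumberTheory.GaloisRepresentations.FramedRep.charpoly ρ σ - Literature.NumberTheory.Automorphic.arithFrobPolyOfSatake ι v.residueCard 1 α).coeff i) < r)

/-- ChildAssembly (curried deciding theorem of the child route; a helper may not declare the registry-owned name `Assembly`): SSH → ILC → U. -/
def ChildAssembly : Prop :=
  SemistableShaping → IwahoriLevelConfinement → Summit.Langlands.Langlands.Theses.AuxiliaryLevelSplit.LevelFiniteness

/-! ## 3. Structured readings (all `Iff.rfl`: the one-liners ARE the structured statements) -/

/-- SSH unfolded to the structured vocabulary (level-free pro-automorphic ⇒ semistably shaped pro-automorphic). -/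
theorem semistableShaping_iff : SemistableShaping ↔
    ∀ (K : Type) [Field K] [NumberField K] (n : ℕ) (hcpt : isCompact_glFiniteIntegralLevel n K), 0 < n →
      ∀ (ℓ : ℕ) [Fact ℓ.Prime] (ι : PadicAlgCl ℓ ≃+* ℂ) (ρ : FramedGaloisRep K (PadicAlgCl ℓ) n),
        ρ.toGaloisRep.IsIrreducible → IsPinnedGeometric ρ →
        IsLevelFreeProAutomorphic hcpt ι ρ → IsShapedProAutomorphic hcpt ι ρ :=
  Iff.rfl

/-- ILC unfolded to the structured vocabulary (semistably shaped pro-automorphic ⇒ pro-automorphic of bounded level). -/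
theorem iwahoriLevelConfinement_iff : IwahoriLevelConfinement ↔
    ∀ (K : Type) [Field K] [NumberField K] (n : ℕ) (hcpt : isCompact_glFiniteIntegralLevel n K), 0 < n →
      ∀ (ℓ : ℕ) [Fact ℓ.Prime] (ι : PadicAlgCl ℓ ≃+* ℂ) (ρ : FramedGaloisRep K (PadicAlgCl ℓ) n),
        ρ.toGaloisRep.IsIrreducible → IsPinnedGeometric ρ →
        IsShapedProAutomorphic hcpt ι ρ → IsProAutomorphic hcpt ι ρ :=
  Iff.rfl

/-! ## 4. Kernel lemmas on the ladder of depths  H∞ ⟸ H♯ ⟸ C ⟸ (weak automorphy) -/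

section Kernel

variable {K : Type} [Field K] [NumberField K] {n : ℕ} {hcpt : isCompact_glFiniteIntegralLevel n K} {ℓ : ℕ} [Fact ℓ.Prime]
  {ι : PadicAlgCl ℓ ≃+* ℂ} {ρ : FramedGaloisRep K (PadicAlgCl ℓ) n}

/-- C ⇒ H♯: one finite `S` good for every radius is a fortiori a shaping set (first disjunct everywhere off `S`; a.e. since `S` is finite). -/
theorem shaped_of_pro (h : IsProAutomorphic hcpt ι ρ) : IsShapedProAutomorphic hcpt ι ρ := by
  obtain ⟨S, hS, h⟩ := h
  refine ⟨S, hS, fun r hr => ?_⟩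
  obtain ⟨π, hπ, hclose⟩ := h r hr
  refine ⟨π, hπ, Filter.eventually_cofinite.mpr (hS.subset fun w hw => ?_), fun v hv => Or.inl (hclose v hv)⟩
  by_contra hwS
  exact hw (hclose w hwS)

/-- H♯ ⇒ H∞: forget the shaping clause. -/
theorem levelFree_of_shaped (h : IsShapedProAutomorphic hcpt ι ρ) : IsLevelFreeProAutomorphic hcpt ι ρ := by
  obtain ⟨S₀, _hS₀, h⟩ := h
  intro r hr
  obtain ⟨π, hπ, hae, _hshape⟩ := h r hr
  exact ⟨π, hπ, hae⟩

/-- weak automorphy ⇒ H♯ (constant approximating family; through `TransientLevel.pro_of_weakly`). -/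
theorem shaped_of_weakly (h : IsWeaklyAutomorphic hcpt ι ρ) : IsShapedProAutomorphic hcpt ι ρ :=
  shaped_of_pro (pro_of_weakly h)

/-- H♯ ⇒ C_pt is NOT a kernel (it is the content of level lowering at the Iwahori places); but H♯ ∧ (H∞ ⇒ C_pt) ⇒ C_pt trivially. -/
theorem placewise_of_shaped_of_placewiseControl (h : IsShapedProAutomorphic hcpt ι ρ)
    (hU₁ : IsLevelFreeProAutomorphic hcpt ι ρ → IsPlacewiseProAutomorphic hcpt ι ρ) : IsPlacewiseProAutomorphic hcpt ι ρ :=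
  hU₁ (levelFree_of_shaped h)

end Kernel

/-! ## 5. The node: deciding theorem, necessity from the target, THE ONE EQUIV -/

/-- DECIDING THEOREM of the node / child route (D-0027 §2.1): SSH → ILC → U, concluding the target BY NAME; both binders used. -/
theorem closes_target (h₁ : SemistableShaping) (h₂ : IwahoriLevelConfinement) :
    Summit.Langlands.Langlands.Theses.AuxiliaryLevelSplit.LevelFiniteness := by
  intro K _ _ n hcpt hn ℓ _ ι ρ hirr hgeo hinf
  exact h₂ K n hcpt hn ℓ ι ρ hirr hgeo (h₁ K n hcpt hn ℓ ι ρ hirr hgeo hinf)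

/-- `ChildAssembly` holds (it is `closes_target`). -/
theorem childAssembly_proof : ChildAssembly := fun h₁ h₂ => closes_target h₁ h₂

/-- NECESSITY: U ⇒ SSH (bounded level is a fortiori semistably shaped: C ⇒ H♯). -/
theorem shaping_of_levelFiniteness (hU : Summit.Langlands.Langlands.Theses.AuxiliaryLevelSplit.LevelFiniteness) :
    SemistableShaping := by
  intro K _ _ n hcpt hn ℓ _ ι ρ hirr hgeo hinf
  exact shaped_of_pro (hU K n hcpt hn ℓ ι ρ hirr hgeo hinf)

/-- NECESSITY: U ⇒ ILC (H♯ ⇒ H∞, then U). -/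
theorem confinement_of_levelFiniteness (hU : Summit.Langlands.Langlands.Theses.AuxiliaryLevelSplit.LevelFiniteness) :
    IwahoriLevelConfinement := by
  intro K _ _ n hcpt hn ℓ _ ι ρ hirr hgeo hsh
  exact hU K n hcpt hn ℓ ι ρ hirr hgeo (levelFree_of_shaped hsh)

/-- THE ONE EQUIV of the node (lens-3): U ⟺ SSH ∧ ILC, modulo NOTHING. -/
theorem levelFiniteness_iff_pieces :
    Summit.Langlands.Langlands.Theses.AuxiliaryLevelSplit.LevelFiniteness ↔ SemistableShaping ∧ IwahoriLevelConfinement :=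
  ⟨fun h => ⟨shaping_of_levelFiniteness h, confinement_of_levelFiniteness h⟩, fun h => closes_target h.1 h.2⟩

/-! ## 6. Necessity from FERN (25024), from B_w (17414, by name) and from the summit -/

/-- SSH is FERN-implied (through the gen-24 tree theorem `TransientLevel.levelFiniteness_of_fernSpread`). -/
theorem semistableShaping_of_fernSpread (hF : Summit.Langlands.Langlands.Theses.DepthPrimeSplit.FernSpread) : SemistableShaping :=
  shaping_of_levelFiniteness (levelFiniteness_of_fernSpread hF)

/-- ILC is FERN-implied. -/
theorem iwahoriLevelConfinement_of_fernSpread (hF : Summit.Langlands.Langlands.Theses.DepthPrimeSplit.FernSpread) :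
    IwahoriLevelConfinement :=
  confinement_of_levelFiniteness (levelFiniteness_of_fernSpread hF)

/-- SSH is B_w-implied. -/
theorem semistableShaping_of_weak (hB : Summit.Langlands.Langlands.Theses.PrimeSwitchSplit.WeakGeometricAutomorphy) :
    SemistableShaping := by
  intro K _ _ n hcpt hn ℓ _ ι ρ hirr hgeo _hinf
  exact shaped_of_weakly (hB K n hcpt hn ℓ ι ρ hirr hgeo)

/-- ILC is B_w-implied. -/
theorem iwahoriLevelConfinement_of_weak (hB : Summit.Langlands.Langlands.Theses.PrimeSwitchSplit.WeakGeometricAutomorphy) :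
    IwahoriLevelConfinement := by
  intro K _ _ n hcpt hn ℓ _ ι ρ hirr hgeo _hsh
  exact pro_of_weakly (hB K n hcpt hn ℓ ι ρ hirr hgeo)

/-- SSH is implied by the summit (`Langlands ⟹ B_w` is the tree theorem `Theorems.DepthPrimeSplitClassicalityWeight.weak_of_langlands`). -/
theorem semistableShaping_of_langlands (hL : _root_.Langlands) : SemistableShaping :=
  semistableShaping_of_weak (Summit.Langlands.Langlands.Theorems.DepthPrimeSplitClassicalityWeight.weak_of_langlands hL)

/-- ILC is implied by the summit. -/
theorem iwahoriLevelConfinement_of_langlands (hL : _root_.Langlands) : IwahoriLevelConfinement :=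
  iwahoriLevelConfinement_of_weak (Summit.Langlands.Langlands.Theorems.DepthPrimeSplitClassicalityWeight.weak_of_langlands hL)

/-- ROOT-IMPLIED certificate for the whole node: the summit implies both pieces (no EXCESS). -/
theorem pieces_of_langlands (hL : _root_.Langlands) : SemistableShaping ∧ IwahoriLevelConfinement :=
  ⟨semistableShaping_of_langlands hL, iwahoriLevelConfinement_of_langlands hL⟩

/-! ## 7. Relation to the gen-24 pieces U₁ = `TransientLevel.PlacewiseLevelControl` (H∞ ⟹ C_pt), U₂ = `TransientLevel.UniformLevelControl`
(C_pt ⟹ C) — node-only statements, NOT items -/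

/-- IWC_pt · PLACEWISE IWAHORI CONFINEMENT: (H♯ ∧ C_pt) ⟹ C — the weakest residual form, implied by ILC and by U₂. -/
def PlacewiseIwahoriConfinement : Prop :=
  ∀ (K : Type) [Field K] [NumberField K] (n : ℕ) (hcpt : isCompact_glFiniteIntegralLevel n K), 0 < n →
    ∀ (ℓ : ℕ) [Fact ℓ.Prime] (ι : PadicAlgCl ℓ ≃+* ℂ) (ρ : FramedGaloisRep K (PadicAlgCl ℓ) n),
      ρ.toGaloisRep.IsIrreducible → IsPinnedGeometric ρ →
      IsShapedProAutomorphic hcpt ι ρ → IsPlacewiseProAutomorphic hcpt ι ρ → IsProAutomorphic hcpt ι ρ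

/-- SSH_pt · PLACEWISE SHAPING: C_pt ⟹ H♯ (implied by SSH, since C_pt ⟹ H∞). -/
def PlacewiseShaping : Prop :=
  ∀ (K : Type) [Field K] [NumberField K] (n : ℕ) (hcpt : isCompact_glFiniteIntegralLevel n K), 0 < n →
    ∀ (ℓ : ℕ) [Fact ℓ.Prime] (ι : PadicAlgCl ℓ ≃+* ℂ) (ρ : FramedGaloisRep K (PadicAlgCl ℓ) n),
      ρ.toGaloisRep.IsIrreducible → IsPinnedGeometric ρ →
      IsPlacewiseProAutomorphic hcpt ι ρ → IsShapedProAutomorphic hcpt ι ρ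

/-- ILC ⟹ IWC_pt (drop the hypothesis C_pt). -/
theorem placewiseConfinement_of_confinement (h : IwahoriLevelConfinement) : PlacewiseIwahoriConfinement := by
  intro K _ _ n hcpt hn ℓ _ ι ρ hirr hgeo hsh _hpt
  exact h K n hcpt hn ℓ ι ρ hirr hgeo hsh

/-- U₂ ⟹ IWC_pt (drop the hypothesis H♯). -/
theorem placewiseConfinement_of_uniform (h : UniformLevelControl) : PlacewiseIwahoriConfinement := by
  intro K _ _ n hcpt hn ℓ _ ι ρ hirr hgeo _hsh hpt
  exact h K n hcpt hn ℓ ι ρ hirr hgeo hpt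

/-- SSH ⟹ SSH_pt (C_pt ⟹ H∞ ⟹ H♯). -/
theorem placewiseShaping_of_shaping (h : SemistableShaping) : PlacewiseShaping := by
  intro K _ _ n hcpt hn ℓ _ ι ρ hirr hgeo hpt
  exact h K n hcpt hn ℓ ι ρ hirr hgeo (levelFree_of_placewise hpt)

/-- U₂ ⟹ SSH_pt (C_pt ⟹ C ⟹ H♯). -/
theorem placewiseShaping_of_uniform (h : UniformLevelControl) : PlacewiseShaping := by
  intro K _ _ n hcpt hn ℓ _ ι ρ hirr hgeo hpt
  exact shaped_of_pro (h K n hcpt hn ℓ ι ρ hirr hgeo hpt)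

/-- SSH ∧ ILC ⟹ U₂: the gen-24 residual follows from this generation's two pieces (conversely U₂ ∧ U₁ ⟹ U ⟹ SSH ∧ ILC). -/
theorem uniform_of_shaping_confinement (h₁ : SemistableShaping) (h₂ : IwahoriLevelConfinement) : UniformLevelControl :=
  uniform_of_levelFiniteness (closes_target h₁ h₂)

/-- THREE-PIECE READING: U ⟺ U₁ ∧ SSH ∧ IWC_pt (exact; U₁ = the gen-24 tree decl BY NAME). -/
theorem levelFiniteness_iff_pieces3 :
    Summit.Langlands.Langlands.Theses.AuxiliaryLevelSplit.LevelFiniteness ↔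
      PlacewiseLevelControl ∧ SemistableShaping ∧ PlacewiseIwahoriConfinement := by
  refine ⟨fun h => ⟨placewise_of_levelFiniteness h, shaping_of_levelFiniteness h,
    placewiseConfinement_of_confinement (confinement_of_levelFiniteness h)⟩, fun ⟨h₁, h₂, h₃⟩ => ?_⟩
  intro K _ _ n hcpt hn ℓ _ ι ρ hirr hgeo hinf
  exact h₃ K n hcpt hn ℓ ι ρ hirr hgeo (h₂ K n hcpt hn ℓ ι ρ hirr hgeo hinf) (h₁ K n hcpt hn ℓ ι ρ hirr hgeo hinf)

/-- LAYER-2 READING of the gen-24 residual: U₂ ⟺ SSH_pt ∧ IWC_pt (exact). -/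
theorem uniformLevelControl_iff_layer2 : UniformLevelControl ↔ PlacewiseShaping ∧ PlacewiseIwahoriConfinement := by
  refine ⟨fun h => ⟨placewiseShaping_of_uniform h, placewiseConfinement_of_uniform h⟩, fun ⟨h₁, h₂⟩ => ?_⟩
  intro K _ _ n hcpt hn ℓ _ ι ρ hirr hgeo hpt
  exact h₂ K n hcpt hn ℓ ι ρ hirr hgeo (h₁ K n hcpt hn ℓ ι ρ hirr hgeo hpt) hpt

/-! ## 9. The frames: the parent's and the grandparent's deciding theorems with U replaced by SSH, ILC -/

/-- Parent frame: G → SSH → ILC → FERN through `AuxiliaryLevelSplit.closes`. -/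
theorem closes_parent (hG : Summit.Langlands.Langlands.Theses.AuxiliaryLevelSplit.LevelFreeFern) (h₁ : SemistableShaping)
    (h₂ : IwahoriLevelConfinement) : Summit.Langlands.Langlands.Theses.DepthPrimeSplit.FernSpread :=
  Summit.Langlands.Langlands.Theses.AuxiliaryLevelSplit.closes hG (closes_target h₁ h₂)

/-- Root frame: the grandparent's deciding theorem with FERN replaced by G, SSH, ILC (ten binders → the summit). -/
theorem closes_root (hD : Summit.Langlands.Langlands.Theses.DepthPrimeSplit.DyadicSeed) (hO : Summit.Langlands.Langlands.Theses.DepthPrimeSplit.OddPrimeSeed)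
    (hG : Summit.Langlands.Langlands.Theses.AuxiliaryLevelSplit.LevelFreeFern) (h₁ : SemistableShaping) (h₂ : IwahoriLevelConfinement)
    (hC : Summit.Langlands.Langlands.Theses.DepthPrimeSplit.Classicality) (hW : Summit.Langlands.Langlands.Theses.DepthPrimeSplit.SatakeAvatarExistence)
    (hP : Summit.Langlands.Langlands.Theses.DepthPrimeSplit.PadicMemberCompatibility)
    (hA : Summit.Langlands.Langlands.Theses.DepthPrimeSplit.CompatibilityAwayFromLR) (hR : Summit.Langlands.Langlands.Theses.DepthPrimeSplit.CanonicalReciprocityData) :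
    _root_.Langlands :=
  Summit.Langlands.Langlands.Theses.DepthPrimeSplit.closes hD hO (closes_parent hG h₁ h₂) hC hW hP hA hR

#print axioms closes_target
#print axioms levelFiniteness_iff_pieces
#print axioms pieces_of_langlands
#print axioms closes_root

end Summit.Langlands.Langlands.Theorems.IwahoriTransient
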